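import Literature.MathematicalPhysics.QuantumFieldTheory.OSTimeLorentzSwap
import Literature.MathematicalPhysics.QuantumLattice.SchwartzTranslationCutoff
import Literature.MathematicalPhysics.QuantumLattice.LocalTubeUniqueness
import Mathlib.Analysis.Calculus.LineDeriv.IntegrationByParts
import Mathlib.Analysis.Distribution.AEEqOfIntegralContDiff
import HarnessLib

/-!
# The boost generators annihilate the time-ray boundary value of an OS time continuation

Topic `Literature/MathematicalPhysics/QuantumFieldTheory`; third support file (everything proved)
for the discharge of (B) `OS1973_lorentzInvariant_of_timeContinuation` of
`Literature.MathematicalPhysics.QuantumFieldTheory.OSTimeContinuation` — Osterwalder–Schrader I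
(1973), §4.2, (4.14): `X_{0i} W̃ₙ = 0` for the generators `X_{0i}` of the boosts, derived from
the rotation invariance (4.15) of the Schwinger functions. With the slices
`A_τ(F) = ∫ 𝔚(y + iτ̂) F(y) dy` (`τ̂ = timeLift τ`, `τ` in the time cone `C₊`) of a function `𝔚`
continuous on the time tube, holomorphic in the times and of OS growth:

* `boostGen i` — **the boost generator in the `(0, i)`-plane on test functions**,
  `X_i G = ∑ₖ (y⁰_k ∂_{e_i,k} G + yⁱ_k ∂_{e₀,k} G)` (a continuous linear map of `𝓢`,
  `coordMul`/`boostGen_apply`);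
* `continuousOn_integral_rayC_timeLift` — the slices are continuous in `τ ∈ C₊` (dominated
  convergence, uniform OS growth on compact sets of heights);
* `integral_rayC_mul_boostGen_eq` — **the key identity**: for `τ ∈ C₊` and compactly supported `G`,
  `A_τ(X_i G) = −i ∑ₖ τ_k A_τ(∂_{e_i,k} G)`. Proof: the weighted identity of `OSTimeLorentzSwap`
  (`integral_weight_slices_eq_zero`), an integration by parts in `τ_k` moving the derivative from
  the weight `h` onto `τ ↦ A_τ(yⁱ_k G)` — whose derivative is `−i A_τ(yⁱ_k ∂_{e₀,k} G)` by the
  Cauchy–Riemann identity for smeared slices (`hasDerivAt_integral_rayC_I_add_smul` of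
  `OSTimeSlice`; Mathlib's `integral_bilinear_hasLineDerivAt_right_eq_neg_left_of_integrable`
  needs the derivative only on the support of `h`) — and du Bois-Reymond's lemma on the open
  cone `C₊` (`IsOpen.ae_eq_zero_of_integral_contDiff_smul_eq_zero`);
* `apply_boostGen_eq_zero` — **`T(X_i G) = 0`** for the time-ray boundary value `T` of `𝔚` and
  every Schwartz `G`: along `τ = tη` the right-hand side of the key identity tends to
  `−i ∑ₖ 0 · T(∂_{e_i,k} G) = 0` while the left-hand side tends to `T(X_i G)`; compactly supported
  `G` are dense (`exists_hasCompactSupport_tendsto`).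

The last file (`OSTimeLorentz`) integrates `T ∘ X_i = 0` to the finite boosts and assembles (B).

## References

* K. Osterwalder, R. Schrader, *Axioms for Euclidean Green's functions*, Comm. Math. Phys. 31
  (1973) 83–112, §4.2, eqs. (4.14)–(4.17). [OsterwalderSchraderCMP1973]
-/

noncomputable section

open MeasureTheory Filter Set Metric Complex
open scoped Topology SchwartzMap LineDeriv ContDiff
open Literature.MathematicalPhysics.QuantumLattice Literature.Analysis.FunctionSpaces

namespace Literature.MathematicalPhysics.QuantumFieldTheory

variable {d n : ℕ}

/-! ### Coordinate multipliers and the boost generator on test functions -/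

/-- The coordinate `y ↦ y_k^μ` as a complex-valued function of temperate growth. [folklore] -/
theorem hasTemperateGrowth_coord (k : Fin n) (μ : Fin (d + 1)) :
    Function.HasTemperateGrowth fun y : Fin n → SpaceTime d => ((y k μ : ℝ) : ℂ) :=
  (Complex.ofRealCLM.comp ((EuclideanSpace.proj μ).comp
    (ContinuousLinearMap.proj (R := ℝ) (φ := fun _ : Fin n => SpaceTime d) k))).hasTemperateGrowth

/-- Multiplication of a test function by the coordinate `y_k^μ`. [folklore] -/
def coordMul (k : Fin n) (μ : Fin (d + 1)) :
    𝓢((Fin n → SpaceTime d), ℂ) →L[ℂ] 𝓢((Fin n → SpaceTime d), ℂ) :=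
  SchwartzMap.smulLeftCLM ℂ fun y : Fin n → SpaceTime d => ((y k μ : ℝ) : ℂ)

/-- Values of `coordMul`. [folklore] -/
@[simp] theorem coordMul_apply (k : Fin n) (μ : Fin (d + 1)) (G : 𝓢((Fin n → SpaceTime d), ℂ))
    (y : Fin n → SpaceTime d) : coordMul k μ G y = (y k μ : ℂ) * G y := by
  rw [coordMul, SchwartzMap.smulLeftCLM_apply_apply (hasTemperateGrowth_coord k μ), smul_eq_mul]

/-- **The boost generator in the `(0, i)`-plane on test functions**,
`X_i G = ∑ₖ (y⁰_k ∂_{e_i,k} G + yⁱ_k ∂_{e₀,k} G)` (Osterwalder–Schrader I (1973), (4.14): the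
operators `X_{ij}`). [cite: OsterwalderSchraderCMP1973, §4.2 eq. (4.14)] -/
def boostGen (i : Fin d) : 𝓢((Fin n → SpaceTime d), ℂ) →L[ℂ] 𝓢((Fin n → SpaceTime d), ℂ) :=
  ∑ k : Fin n, ((coordMul k 0).comp (LineDeriv.lineDerivOpCLM ℂ _ (unitDir k i.succ)) +
    (coordMul k i.succ).comp (LineDeriv.lineDerivOpCLM ℂ _ (unitDir k (0 : Fin (d + 1)))))

/-- Values of the boost generator. [folklore] -/
theorem boostGen_apply (i : Fin d) (G : 𝓢((Fin n → SpaceTime d), ℂ)) (y : Fin n → SpaceTime d) :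
    boostGen i G y = ∑ k, ((y k 0 : ℂ) * ∂_{unitDir k i.succ} G y +
      (y k i.succ : ℂ) * ∂_{unitDir k (0 : Fin (d + 1))} G y) := by
  simp [boostGen, LineDeriv.lineDerivOpCLM_apply]

/-- **Derivative of a coordinate multiple along an orthogonal direction**:
`∂_{e_{ν,j}} (y_k^μ G) = y_k^μ ∂_{e_{ν,j}} G` when `(j, ν) ≠ (k, μ)`. [folklore] -/
theorem lineDerivOp_coordMul_of_ne (k j : Fin n) (μ ν : Fin (d + 1)) (h : ¬(k = j ∧ μ = ν))
    (G : 𝓢((Fin n → SpaceTime d), ℂ)) (y : Fin n → SpaceTime d) :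
    ∂_{unitDir j ν} (coordMul k μ G) y = (y k μ : ℂ) * ∂_{unitDir j ν} G y := by
  rw [SchwartzMap.lineDerivOp_apply_eq_fderiv, SchwartzMap.lineDerivOp_apply_eq_fderiv]
  have hfun : ((coordMul k μ G : 𝓢((Fin n → SpaceTime d), ℂ)) : (Fin n → SpaceTime d) → ℂ) =
      fun y => ((y k μ : ℝ) : ℂ) * G y := funext fun y => coordMul_apply k μ G y
  rw [hfun]
  set L : (Fin n → SpaceTime d) →L[ℝ] ℂ := Complex.ofRealCLM.comp ((EuclideanSpace.proj μ).comp
    (ContinuousLinearMap.proj (R := ℝ) (φ := fun _ : Fin n => SpaceTime d) k)) with hL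
  have hLapp : ∀ y : Fin n → SpaceTime d, L y = ((y k μ : ℝ) : ℂ) := fun y => rfl
  have hc : DifferentiableAt ℝ (fun y : Fin n → SpaceTime d => ((y k μ : ℝ) : ℂ)) y :=
    L.differentiableAt
  have hderiv : fderiv ℝ (fun y : Fin n → SpaceTime d => ((y k μ : ℝ) : ℂ)) y (unitDir j ν) = 0 := by
    have : (fun y : Fin n → SpaceTime d => ((y k μ : ℝ) : ℂ)) = L := funext fun y => (hLapp y).symm
    rw [this, L.fderiv, hLapp, unitDir_apply]
    rw [if_neg h]
    simp
  rw [fderiv_fun_mul hc G.differentiableAt]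
  simp [hderiv]

/-! ### Continuity of the slices in the height -/

section Slices

variable {𝔚 : (Fin n → Fin (d + 1) → ℂ) → ℂ} {C : ℝ} {N : ℕ}

/-- **The slices `τ ↦ ∫ 𝔚(y + iτ̂) F(y) dy` are continuous on the time cone** (dominated
convergence: `𝔚` is continuous on the time tube and of uniform polynomial growth over compact
sets of heights). [folklore] -/
theorem continuousOn_integral_rayC_timeLift (hGc : ContinuousOn 𝔚 (timeTube d n))
    (hG : ∀ z ∈ timeTube d n, ‖𝔚 z‖ ≤ C * (1 + ‖z‖) ^ N *
      (1 + ∑ k, ((succDiff (fun j => z j 0) k).im)⁻¹) ^ N)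
    (F : 𝓢((Fin n → SpaceTime d), ℂ)) :
    ContinuousOn (fun τ : Fin n → ℝ => ∫ y, 𝔚 (rayC y (timeLift τ) I) * F y) (timeCone n) := by
  intro τ₀ hτ₀
  refine ContinuousAt.continuousWithinAt ?_
  obtain ⟨r, hr, hball⟩ := Metric.isOpen_iff.1 isOpen_timeCone τ₀ hτ₀
  set K : Set (Fin n → ℝ) := closedBall τ₀ (r / 2) with hK
  have hKc : IsCompact K := isCompact_closedBall _ _
  have hKC : K ⊆ timeCone n := (closedBall_subset_ball (half_lt_self hr)).trans hball
  have hKτ : IsCompact ((fun τ => (timeLift τ : Fin n → SpaceTime d)) '' K) :=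
    hKc.image (continuous_pi fun k => (continuous_apply k).smul continuous_const)
  have hKτT : (fun τ => (timeLift τ : Fin n → SpaceTime d)) '' K ⊆ temporalCone d n := by
    rintro _ ⟨τ, hτ, rfl⟩
    exact (timeLift_mem_temporalCone_iff τ).2 (hKC hτ)
  obtain ⟨A, hA0, hA⟩ := exists_norm_apply_rayC_I_le_of_isCompact hG hKτ hKτT
  have hKn : K ∈ 𝓝 τ₀ := closedBall_mem_nhds τ₀ (half_pos hr)
  refine continuousAt_of_dominated (bound := fun y => A * ((1 + ‖y‖) ^ N * ‖F y‖)) ?_ ?_ ?_ ?_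
  · filter_upwards [hKn] with τ hτ
    exact ((continuous_apply_rayC_I hGc ((timeLift_mem_temporalCone_iff τ).2 (hKC hτ))).mul
      F.continuous).aestronglyMeasurable
  · filter_upwards [hKn] with τ hτ
    refine Eventually.of_forall fun y => ?_
    rw [norm_mul]
    calc ‖𝔚 (rayC y (timeLift τ) I)‖ * ‖F y‖ ≤ A * (1 + ‖y‖) ^ N * ‖F y‖ :=
          mul_le_mul_of_nonneg_right (hA _ ⟨τ, hτ, rfl⟩ y) (norm_nonneg _)
      _ = A * ((1 + ‖y‖) ^ N * ‖F y‖) := by ring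
  · exact (integrable_one_add_norm_pow_mul_norm F N).const_mul A
  · refine Eventually.of_forall fun y => ?_
    have hlim : Tendsto (fun τ : Fin n → ℝ => (timeLift τ : Fin n → SpaceTime d)) (𝓝 τ₀)
        (𝓝 (timeLift τ₀)) :=
      (continuous_pi fun k => (continuous_apply k).smul continuous_const).tendsto τ₀
    have hev : ∀ᶠ τ in 𝓝 τ₀, (timeLift τ : Fin n → SpaceTime d) ∈ temporalCone d n := by
      filter_upwards [isOpen_timeCone.mem_nhds hτ₀] with τ hτ
      exact (timeLift_mem_temporalCone_iff τ).2 hτ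
    exact (tendsto_apply_rayC_I hGc hev ((timeLift_mem_temporalCone_iff τ₀).2 hτ₀) hlim y).mul
      tendsto_const_nhds

/-- A function continuous on the time cone multiplied by a function supported inside the time
cone is integrable. [folklore] -/
theorem integrable_mul_of_continuousOn_timeCone {Φ : (Fin n → ℝ) → ℂ}
    (hΦ : ContinuousOn Φ (timeCone n)) {g : (Fin n → ℝ) → ℂ} (hg : Continuous g)
    (hgc : HasCompactSupport g) (hgs : tsupport g ⊆ timeCone n) :
    Integrable (fun τ => g τ * Φ τ) volume := by
  have hc : Continuous fun τ => Φ τ * g τ := continuous_mul_of_tsupport_subset isOpen_timeCone hΦ hg hgs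
  have heq : (fun τ => g τ * Φ τ) = fun τ => Φ τ * g τ := funext fun τ => mul_comm _ _
  rw [heq]
  exact hc.integrable_of_hasCompactSupport hgc.mul_left

/-- The derivative in `τ_k` of the slice `τ ↦ ∫ 𝔚(y + iτ̂) F(y) dy` is `−i ∫ 𝔚(y + iτ̂) (∂_{e₀,k} F)(y) dy`
(the Cauchy–Riemann identity for smeared slices of `OSTimeSlice`, as a line derivative). [folklore] -/
theorem hasLineDerivAt_integral_rayC_timeLift (hGc : ContinuousOn 𝔚 (timeTube d n))
    (hGh : IsTimeHolomorphicOn 𝔚 (timeTube d n))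
    (hG : ∀ z ∈ timeTube d n, ‖𝔚 z‖ ≤ C * (1 + ‖z‖) ^ N *
      (1 + ∑ k, ((succDiff (fun j => z j 0) k).im)⁻¹) ^ N)
    (F : 𝓢((Fin n → SpaceTime d), ℂ)) {τ : Fin n → ℝ} (hτ : τ ∈ timeCone n) (k : Fin n) :
    HasLineDerivAt ℝ (fun τ : Fin n → ℝ => ∫ y, 𝔚 (rayC y (timeLift τ) I) * F y)
      (-I * ∫ y, 𝔚 (rayC y (timeLift τ) I) * ∂_{unitDir k (0 : Fin (d + 1))} F y) τ
      (Pi.single k 1) := by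
  have hy : ∀ (j : Fin n) (i : Fin d), (timeLift τ : Fin n → SpaceTime d) j i.succ = 0 :=
    fun j i => timeLift_apply_succ τ j i
  have hθ : ∀ (j : Fin n) (i : Fin d), (unitDir k (0 : Fin (d + 1)) : Fin n → SpaceTime d) j i.succ = 0 :=
    fun j i => by rw [unitDir_apply]; simp [Fin.succ_ne_zero]
  have hs₀ : (timeLift τ : Fin n → SpaceTime d) + (0 : ℝ) • unitDir k (0 : Fin (d + 1)) ∈ temporalCone d n := by
    simpa using (timeLift_mem_temporalCone_iff τ).2 hτ
  have h := hasDerivAt_integral_rayC_I_add_smul hGc hGh hG hy hθ hs₀ F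
  simp only [zero_smul, add_zero] at h
  unfold HasLineDerivAt
  have hfun : (fun t : ℝ => ∫ y, 𝔚 (rayC y (timeLift (τ + t • Pi.single k (1 : ℝ))) I) * F y) =
      fun t : ℝ => ∫ y, 𝔚 (rayC y ((timeLift τ : Fin n → SpaceTime d) + t • unitDir k (0 : Fin (d + 1))) I) * F y := by
    funext t
    rw [timeLift_add, timeLift_smul, timeLift_single]
  rw [hfun]
  exact h

end Slices

/-! ### The key identity -/

section Key

variable {S : SchwingerFamily (EuclideanSpace ℝ (Fin (d + 1)))} {𝔚 : (Fin n → Fin (d + 1) → ℂ) → ℂ}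
  {C : ℝ} {N : ℕ}

/-- **The key identity** (Osterwalder–Schrader I (1973), §4.2, (4.15) ⇒ (4.14) at fixed height):
under E1, for `𝔚` continuous on the time tube, holomorphic in the times, of OS growth, with
Euclidean restriction `𝔖ₙ` on time-ordered test functions, for every compactly supported Schwartz
`G`, spatial direction `i` and `τ` in the time cone,

  `∫ 𝔚(y + iτ̂) (X_i G)(y) dy = −i ∑ₖ τ_k ∫ 𝔚(y + iτ̂) (∂_{e_i,k} G)(y) dy`.

Proof: with `Θ(τ)` the difference of the two sides, the weighted identity
`integral_weight_slices_eq_zero` and an integration by parts in `τ_k` (derivative of the slices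
`hasLineDerivAt_integral_rayC_timeLift`, Leibniz `lineDerivOp_coordMul_of_ne`) give
`∫ h(τ) Θ(τ) dτ = 0` for all smooth `h` compactly supported in the cone; `Θ` is continuous on the
cone, so `Θ = 0` there (du Bois-Reymond). [cite: OsterwalderSchraderCMP1973, §4.2 eqs. (4.14)–(4.17)] -/
theorem integral_rayC_mul_boostGen_eq (hE1 : S.IsEuclideanCovariant)
    (hGc : ContinuousOn 𝔚 (timeTube d n)) (hGh : IsTimeHolomorphicOn 𝔚 (timeTube d n))
    (hG : ∀ z ∈ timeTube d n, ‖𝔚 z‖ ≤ C * (1 + ‖z‖) ^ N *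
      (1 + ∑ k, ((succDiff (fun j => z j 0) k).im)⁻¹) ^ N)
    (hS : ∀ F : 𝓢((Fin n → EuclideanSpace ℝ (Fin (d + 1))), ℂ), IsTimeOrdered F →
      S n F = ∫ x, 𝔚 (euclideanPoint x) * F x)
    (i : Fin d) (G : 𝓢((Fin n → SpaceTime d), ℂ))
    (hGK : HasCompactSupport (G : (Fin n → SpaceTime d) → ℂ)) {τ : Fin n → ℝ} (hτ : τ ∈ timeCone n) :
    ∫ y, 𝔚 (rayC y (timeLift τ) I) * boostGen i G y =
      -I * ∑ k : Fin n, (τ k : ℂ) * ∫ y, 𝔚 (rayC y (timeLift τ) I) * ∂_{unitDir k i.succ} G y := by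
  -- the slices as functions of the height
  set A : 𝓢((Fin n → SpaceTime d), ℂ) → (Fin n → ℝ) → ℂ := fun F σ =>
    ∫ y, 𝔚 (rayC y (timeLift σ) I) * F y with hA
  have hAc : ∀ F, ContinuousOn (A F) (timeCone n) := fun F => continuousOn_integral_rayC_timeLift hGc hG F
  -- the difference of the two sides, continuous on the cone
  set Θ : (Fin n → ℝ) → ℂ := fun σ => A (boostGen i G) σ +
    I * ∑ k : Fin n, (σ k : ℂ) * A (∂_{unitDir k i.succ} G) σ with hΘ
  have hΘc : ContinuousOn Θ (timeCone n) := by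
    refine (hAc _).add (continuousOn_const.mul (continuousOn_finsetSum _ fun k _ => ?_))
    exact (continuous_ofReal.comp (continuous_apply k)).continuousOn.mul (hAc _)
  -- `Θ` integrates to zero against every smooth weight supported in the cone
  have hweight : ∀ h : (Fin n → ℝ) → ℝ, ContDiff ℝ ∞ h → HasCompactSupport h →
      tsupport h ⊆ timeCone n → ∫ σ, (h σ : ℂ) * Θ σ = 0 := by
    intro h hh hhc hhC
    have hw := integral_weight_slices_eq_zero hE1 hGc hGh hG hS i G hGK hh hhc hhC
    have hfdc : Continuous (fderiv ℝ h) := hh.continuous_fderiv (by simp)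
    -- continuity and support of the weights
    have hhcC : Continuous fun σ : Fin n → ℝ => (h σ : ℂ) := continuous_ofReal.comp hh.continuous
    have hh'cC : ∀ k, Continuous fun σ : Fin n → ℝ => (fderiv ℝ h σ (Pi.single k 1) : ℂ) := fun k =>
      continuous_ofReal.comp (hfdc.clm_apply continuous_const)
    have hhsC : HasCompactSupport fun σ : Fin n → ℝ => (h σ : ℂ) := hhc.comp_left Complex.ofReal_zero
    have hh'sC : ∀ k, HasCompactSupport fun σ : Fin n → ℝ => (fderiv ℝ h σ (Pi.single k 1) : ℂ) := by
      intro k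
      refine (hhc.fderiv_apply (𝕜 := ℝ) (Pi.single k 1)).comp_left Complex.ofReal_zero
    have htsC : tsupport (fun σ : Fin n → ℝ => (h σ : ℂ)) ⊆ timeCone n :=
      (tsupport_comp_subset Complex.ofReal_zero h).trans hhC
    have hts'C : ∀ k, tsupport (fun σ : Fin n → ℝ => (fderiv ℝ h σ (Pi.single k 1) : ℂ)) ⊆ timeCone n :=
      fun k => ((tsupport_comp_subset Complex.ofReal_zero _).trans
        (tsupport_fderiv_apply_subset ℝ (Pi.single k 1))).trans hhC
    -- integration by parts in `τ_k`
    have hibp : ∀ k, ∫ σ, (fderiv ℝ h σ (Pi.single k 1) : ℂ) * A (coordMul k i.succ G) σ =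
        -∫ σ, (h σ : ℂ) * (-I * A (coordMul k i.succ (∂_{unitDir k (0 : Fin (d + 1))} G)) σ) := by
      intro k
      have hLeib : ∀ σ, (∫ y, 𝔚 (rayC y (timeLift σ) I) * ∂_{unitDir k (0 : Fin (d + 1))} (coordMul k i.succ G) y) =
          ∫ y, 𝔚 (rayC y (timeLift σ) I) * (coordMul k i.succ (∂_{unitDir k (0 : Fin (d + 1))} G)) y := by
        intro σ
        congr 1
        funext y
        rw [lineDerivOp_coordMul_of_ne k k i.succ 0 (fun h' => Fin.succ_ne_zero i h'.2), coordMul_apply]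
      have h1 := integral_bilinear_hasLineDerivAt_right_eq_neg_left_of_integrable (μ := volume)
        (B := ContinuousLinearMap.mul ℝ ℂ) (v := Pi.single k (1 : ℝ))
        (f := fun σ : Fin n → ℝ => (h σ : ℂ)) (f' := fun σ => (fderiv ℝ h σ (Pi.single k 1) : ℂ))
        (g := A (coordMul k i.succ G))
        (g' := fun σ => -I * A (coordMul k i.succ (∂_{unitDir k (0 : Fin (d + 1))} G)) σ) ?_ ?_ ?_ ?_ ?_
      · simp only [ContinuousLinearMap.mul_apply'] at h1
        rw [h1, neg_neg]
      · simp only [ContinuousLinearMap.mul_apply']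
        exact integrable_mul_of_continuousOn_timeCone (hAc _) (hh'cC k) (hh'sC k) (hts'C k)
      · simp only [ContinuousLinearMap.mul_apply']
        exact integrable_mul_of_continuousOn_timeCone (continuousOn_const.mul (hAc _)) hhcC hhsC htsC
      · simp only [ContinuousLinearMap.mul_apply']
        exact integrable_mul_of_continuousOn_timeCone (hAc _) hhcC hhsC htsC
      · intro σ _
        have hd : HasFDerivAt (fun σ : Fin n → ℝ => (h σ : ℂ))
            (Complex.ofRealCLM.comp (fderiv ℝ h σ)) σ :=
          Complex.ofRealCLM.hasFDerivAt.comp σ ((hh.differentiable (by simp)) σ).hasFDerivAt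
        exact hd.hasLineDerivAt (Pi.single k 1)
      · intro σ hσ
        have hσC : σ ∈ timeCone n := htsC hσ
        have h2 := hasLineDerivAt_integral_rayC_timeLift hGc hGh hG (coordMul k i.succ G) hσC k
        rw [hLeib σ] at h2
        simpa only [hA] using h2
    -- substitute into the weighted identity
    have hApFn : ∀ σ ∈ timeCone n, (∫ y, 𝔚 (rayC y (timeLift σ) I) * pFn i σ G y) =
        A (∑ k : Fin n, coordMul k 0 (∂_{unitDir k i.succ} G)) σ +
          I * ∑ k : Fin n, (σ k : ℂ) * A (∂_{unitDir k i.succ} G) σ := by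
      intro σ hσ
      have hŷ : (timeLift σ : Fin n → SpaceTime d) ∈ temporalCone d n :=
        (timeLift_mem_temporalCone_iff σ).2 hσ
      have hint : ∀ F : 𝓢((Fin n → SpaceTime d), ℂ),
          Integrable (fun y => 𝔚 (rayC y (timeLift σ) I) * F y) volume :=
        fun F => integrable_apply_rayC_I_mul hGc hG hŷ F
      have hpt : ∀ y, 𝔚 (rayC y (timeLift σ) I) * pFn i σ G y =
          𝔚 (rayC y (timeLift σ) I) * (∑ k : Fin n, coordMul k 0 (∂_{unitDir k i.succ} G)) y +
            ∑ k : Fin n, I * (σ k : ℂ) * (𝔚 (rayC y (timeLift σ) I) * ∂_{unitDir k i.succ} G y) := by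
        intro y
        simp only [pFn, _root_.sum_apply, coordMul_apply, Finset.mul_sum, ← Finset.sum_add_distrib]
        refine Finset.sum_congr rfl fun k _ => ?_
        ring
      simp only [hA]
      rw [integral_congr_ae (Eventually.of_forall hpt), integral_add (hint _)
        (integrable_finsetSum _ fun k _ => (hint _).const_mul _), integral_finsetSum _
        fun k _ => (hint _).const_mul _]
      congr 1
      rw [Finset.mul_sum]
      refine Finset.sum_congr rfl fun k _ => ?_
      rw [integral_const_mul]
      ring
    -- the weighted identity in terms of `A`, split into its summands
    have hw' : ∫ σ, ((h σ : ℂ) * (∫ y, 𝔚 (rayC y (timeLift σ) I) * pFn i σ G y) -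
        I * ∑ k, (fderiv ℝ h σ (Pi.single k 1) : ℂ) * A (coordMul k i.succ G) σ) = 0 := by
      simpa only [hA, coordMul_apply] using hw
    have hsplit : (∫ σ, (h σ : ℂ) * ∫ y, 𝔚 (rayC y (timeLift σ) I) * pFn i σ G y) -
        I * ∑ k, ∫ σ, (fderiv ℝ h σ (Pi.single k 1) : ℂ) * A (coordMul k i.succ G) σ = 0 := by
      rw [← hw']
      have hI1 : Integrable (fun σ => (h σ : ℂ) * ∫ y, 𝔚 (rayC y (timeLift σ) I) * pFn i σ G y) volume := by
        have hcont : ContinuousOn (fun σ => ∫ y, 𝔚 (rayC y (timeLift σ) I) * pFn i σ G y) (timeCone n) := by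
          have heq : EqOn (fun σ => ∫ y, 𝔚 (rayC y (timeLift σ) I) * pFn i σ G y)
              (fun σ => A (∑ k : Fin n, coordMul k 0 (∂_{unitDir k i.succ} G)) σ +
                I * ∑ k : Fin n, (σ k : ℂ) * A (∂_{unitDir k i.succ} G) σ) (timeCone n) := hApFn
          refine ContinuousOn.congr ?_ heq
          refine (hAc _).add (continuousOn_const.mul (continuousOn_finsetSum _ fun k _ => ?_))
          exact (continuous_ofReal.comp (continuous_apply k)).continuousOn.mul (hAc _)
        exact integrable_mul_of_continuousOn_timeCone hcont hhcC hhsC htsC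
      have hI2 : ∀ k, Integrable (fun σ => (fderiv ℝ h σ (Pi.single k 1) : ℂ) *
          A (coordMul k i.succ G) σ) volume :=
        fun k => integrable_mul_of_continuousOn_timeCone (hAc _) (hh'cC k) (hh'sC k) (hts'C k)
      rw [integral_sub hI1 ((integrable_finsetSum _ fun k _ => hI2 k).const_mul _), integral_const_mul,
        integral_finsetSum _ fun k _ => hI2 k]
    -- conclusion of the computation
    have hI3 : ∀ k, Integrable (fun σ => (h σ : ℂ) *
        A (coordMul k i.succ (∂_{unitDir k (0 : Fin (d + 1))} G)) σ) volume :=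
      fun k => integrable_mul_of_continuousOn_timeCone (hAc _) hhcC hhsC htsC
    have hI4 : Integrable (fun σ => (h σ : ℂ) * (A (∑ k : Fin n, coordMul k 0 (∂_{unitDir k i.succ} G)) σ +
        I * ∑ k : Fin n, (σ k : ℂ) * A (∂_{unitDir k i.succ} G) σ)) volume := by
      refine integrable_mul_of_continuousOn_timeCone ?_ hhcC hhsC htsC
      refine (hAc _).add (continuousOn_const.mul (continuousOn_finsetSum _ fun k _ => ?_))
      exact (continuous_ofReal.comp (continuous_apply k)).continuousOn.mul (hAc _)
    -- rewrite `∫ h · (∫ 𝔚 pFn)` through `hApFn` (the integrands agree where `h ≠ 0`)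
    have hfirst : (∫ σ, (h σ : ℂ) * ∫ y, 𝔚 (rayC y (timeLift σ) I) * pFn i σ G y) =
        ∫ σ, (h σ : ℂ) * (A (∑ k : Fin n, coordMul k 0 (∂_{unitDir k i.succ} G)) σ +
          I * ∑ k : Fin n, (σ k : ℂ) * A (∂_{unitDir k i.succ} G) σ) := by
      refine integral_congr_ae (Eventually.of_forall fun σ => ?_)
      by_cases hσ : σ ∈ timeCone n
      · simp only [hApFn σ hσ]
      · have : h σ = 0 := image_eq_zero_of_notMem_tsupport fun h' => hσ (hhC h')
        simp only [this, ofReal_zero, zero_mul]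
    rw [hfirst] at hsplit
    simp_rw [hibp] at hsplit
    -- assemble: `∫ h Θ = (first) - I ∑ (-(∫ h (-I A(...)))) = 0`
    have hΘpt : ∀ σ ∈ timeCone n, Θ σ = (A (∑ k : Fin n, coordMul k 0 (∂_{unitDir k i.succ} G)) σ +
        I * ∑ k : Fin n, (σ k : ℂ) * A (∂_{unitDir k i.succ} G) σ) +
          ∑ k : Fin n, A (coordMul k i.succ (∂_{unitDir k (0 : Fin (d + 1))} G)) σ := by
      intro σ hσ
      have hŷ : (timeLift σ : Fin n → SpaceTime d) ∈ temporalCone d n :=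
        (timeLift_mem_temporalCone_iff σ).2 hσ
      have hint : ∀ F : 𝓢((Fin n → SpaceTime d), ℂ),
          Integrable (fun y => 𝔚 (rayC y (timeLift σ) I) * F y) volume :=
        fun F => integrable_apply_rayC_I_mul hGc hG hŷ F
      simp only [hΘ, hA]
      have hb : ∀ y, 𝔚 (rayC y (timeLift σ) I) * boostGen i G y =
          𝔚 (rayC y (timeLift σ) I) * (∑ k : Fin n, coordMul k 0 (∂_{unitDir k i.succ} G)) y +
            ∑ k : Fin n, 𝔚 (rayC y (timeLift σ) I) * (coordMul k i.succ (∂_{unitDir k (0 : Fin (d + 1))} G)) y := by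
        intro y
        simp only [boostGen_apply, _root_.sum_apply, coordMul_apply, Finset.mul_sum,
          ← Finset.sum_add_distrib]
        refine Finset.sum_congr rfl fun k _ => ?_
        ring
      rw [integral_congr_ae (Eventually.of_forall hb), integral_add (hint _)
        (integrable_finsetSum _ fun k _ => hint _), integral_finsetSum _ fun k _ => hint _]
      ring
    have hlhs : ∫ σ, (h σ : ℂ) * Θ σ = (∫ σ, (h σ : ℂ) * (A (∑ k : Fin n, coordMul k 0 (∂_{unitDir k i.succ} G)) σ +
          I * ∑ k : Fin n, (σ k : ℂ) * A (∂_{unitDir k i.succ} G) σ)) +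
        ∑ k : Fin n, ∫ σ, (h σ : ℂ) * A (coordMul k i.succ (∂_{unitDir k (0 : Fin (d + 1))} G)) σ := by
      rw [← integral_finsetSum _ fun k _ => hI3 k, ← integral_add hI4 (integrable_finsetSum _ fun k _ => hI3 k)]
      refine integral_congr_ae (Eventually.of_forall fun σ => ?_)
      dsimp only
      by_cases hσ : σ ∈ timeCone n
      · rw [hΘpt σ hσ]
        simp only [mul_add, Finset.mul_sum]
      · have : h σ = 0 := image_eq_zero_of_notMem_tsupport fun h' => hσ (hhC h')
        simp only [this, ofReal_zero, zero_mul, Finset.sum_const_zero, add_zero]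
    rw [hlhs]
    have hcalc : ∀ k, -(∫ σ, (h σ : ℂ) * (-I * A (coordMul k i.succ (∂_{unitDir k (0 : Fin (d + 1))} G)) σ)) =
        I * ∫ σ, (h σ : ℂ) * A (coordMul k i.succ (∂_{unitDir k (0 : Fin (d + 1))} G)) σ := by
      intro k
      rw [← integral_neg, ← integral_const_mul]
      refine integral_congr_ae (Eventually.of_forall fun σ => ?_)
      ring
    simp_rw [hcalc] at hsplit
    rw [← Finset.mul_sum, ← mul_assoc, I_mul_I] at hsplit
    linear_combination hsplit
  -- du Bois-Reymond on the open cone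
  have hae : ∀ᵐ σ ∂(volume : Measure (Fin n → ℝ)), σ ∈ timeCone n → Θ σ = 0 := by
    refine isOpen_timeCone.ae_eq_zero_of_integral_contDiff_smul_eq_zero
      (hΘc.locallyIntegrableOn isOpen_timeCone.measurableSet) fun g hg hgc hgC => ?_
    have := hweight g hg hgc hgC
    simpa only [Complex.real_smul] using this
  have hae' : Θ =ᵐ[volume.restrict (timeCone n)] 0 := by
    rw [EventuallyEq, ae_restrict_iff' isOpen_timeCone.measurableSet]
    exact hae
  have hzero := Measure.eqOn_open_of_ae_eq hae' isOpen_timeCone hΘc continuousOn_const hτ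
  simp only [hΘ, hA, Pi.zero_apply] at hzero
  exact eq_neg_of_add_eq_zero_left hzero |>.trans (by ring)

end Key

/-! ### The boundary value is annihilated by the boost generators -/

section BoundaryValue

variable {S : SchwingerFamily (EuclideanSpace ℝ (Fin (d + 1)))} {𝔚 : (Fin n → Fin (d + 1) → ℂ) → ℂ}
  {C : ℝ} {N : ℕ} {T : 𝓢((Fin n → SpaceTime d), ℂ) →L[ℂ] ℂ}

/-- The standard point `η'_k = k + 1` of the time cone, and its positive multiples. [folklore] -/
theorem smul_stdTimes_mem_timeCone {t : ℝ} (ht : 0 < t) :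
    (t • fun k : Fin n => ((k : ℕ) : ℝ) + 1) ∈ timeCone n := by
  intro k
  rw [succDiff_smul']
  refine mul_pos ht ?_
  cases n with
  | zero => exact k.elim0
  | succ m =>
    refine Fin.cases ?_ (fun j => ?_) k
    · simp [succDiff_zero]
    · simp [succDiff_succ]

/-- **The boost generators annihilate the time-ray boundary value** (Osterwalder–Schrader I
(1973), §4.2, (4.14): `X_{0i} W̃ₙ = 0`). Under E1, for `𝔚` continuous on the time tube,
holomorphic in the times, of OS growth, with Euclidean restriction `𝔖ₙ` on time-ordered test
functions and time-ray boundary value `T`: `T (X_i G) = 0` for every Schwartz `G` and every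
spatial direction `i`. Proof: for compactly supported `G`, along `τ = tη'` the key identity
`integral_rayC_mul_boostGen_eq` exhibits the approximants of `T(X_i G)` as
`−i ∑ₖ tη'_k ∫ 𝔚(y + itη̂') ∂_{e_i,k}G`, which tend to `−i ∑ₖ 0 · T(∂_{e_i,k} G) = 0`; general `G` by
density of compactly supported test functions and continuity of `T ∘ X_i`. [cite: OsterwalderSchraderCMP1973, §4.2 eq. (4.14)] -/
theorem apply_boostGen_eq_zero (hE1 : S.IsEuclideanCovariant)
    (hGc : ContinuousOn 𝔚 (timeTube d n)) (hGh : IsTimeHolomorphicOn 𝔚 (timeTube d n))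
    (hG : ∀ z ∈ timeTube d n, ‖𝔚 z‖ ≤ C * (1 + ‖z‖) ^ N *
      (1 + ∑ k, ((succDiff (fun j => z j 0) k).im)⁻¹) ^ N)
    (hS : ∀ F : 𝓢((Fin n → EuclideanSpace ℝ (Fin (d + 1))), ℂ), IsTimeOrdered F →
      S n F = ∫ x, 𝔚 (euclideanPoint x) * F x)
    (hbv : HasTimeRayBoundaryValue 𝔚 T) (i : Fin d) (G : 𝓢((Fin n → SpaceTime d), ℂ)) :
    T (boostGen i G) = 0 := by
  set η' : Fin n → ℝ := fun k => ((k : ℕ) : ℝ) + 1 with hη'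
  have hηT : (timeLift η' : Fin n → SpaceTime d) ∈ temporalCone d n := by
    rw [timeLift_mem_temporalCone_iff]
    simpa using smul_stdTimes_mem_timeCone (n := n) one_pos
  -- compactly supported test functions
  have hcs : ∀ G : 𝓢((Fin n → SpaceTime d), ℂ), HasCompactSupport (G : (Fin n → SpaceTime d) → ℂ) →
      T (boostGen i G) = 0 := by
    intro G hGK
    have hlimL := hbv (timeLift η') hηT (boostGen i G)
    have hlimk : ∀ k : Fin n, Tendsto (fun t : ℝ => ∫ x : Fin n → SpaceTime d,
        𝔚 (fun j => complexifyPoint (x j) + ((t : ℂ) * I) • complexifyPoint ((timeLift η' : Fin n → SpaceTime d) j)) *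
          ∂_{unitDir k i.succ} G x) (𝓝[>] 0) (𝓝 (T (∂_{unitDir k i.succ} G))) :=
      fun k => hbv (timeLift η') hηT (∂_{unitDir k i.succ} G)
    have hKI : ∀ t : ℝ, 0 < t →
        (∫ x : Fin n → SpaceTime d, 𝔚 (fun j => complexifyPoint (x j) +
          ((t : ℂ) * I) • complexifyPoint ((timeLift η' : Fin n → SpaceTime d) j)) * boostGen i G x) =
          -I * ∑ k : Fin n, ((t • η') k : ℂ) * ∫ x : Fin n → SpaceTime d,
            𝔚 (fun j => complexifyPoint (x j) +
              ((t : ℂ) * I) • complexifyPoint ((timeLift η' : Fin n → SpaceTime d) j)) *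
              ∂_{unitDir k i.succ} G x := by
      intro t ht
      have h := integral_rayC_mul_boostGen_eq hE1 hGc hGh hG hS i G hGK (smul_stdTimes_mem_timeCone ht)
      simp only [timeLift_smul, ← Literature.MathematicalPhysics.QuantumLattice.rayC_ofReal_mul_I] at h
      exact h
    have hR : Tendsto (fun t : ℝ => -I * ∑ k : Fin n, ((t • η') k : ℂ) * ∫ x : Fin n → SpaceTime d,
        𝔚 (fun j => complexifyPoint (x j) +
          ((t : ℂ) * I) • complexifyPoint ((timeLift η' : Fin n → SpaceTime d) j)) *
          ∂_{unitDir k i.succ} G x) (𝓝[>] 0) (𝓝 0) := by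
      have h0 : (0 : ℂ) = -I * ∑ k : Fin n, (0 : ℂ) * T (∂_{unitDir k i.succ} G) := by simp
      rw [h0]
      refine Tendsto.const_mul _ (tendsto_finsetSum _ fun k _ => Tendsto.mul ?_ (hlimk k))
      have hc : Continuous fun t : ℝ => (((t • η') k : ℝ) : ℂ) :=
        continuous_ofReal.comp ((continuous_apply k).comp (continuous_id.smul continuous_const))
      have h1 := hc.tendsto (0 : ℝ)
      simp only [zero_smul, Pi.zero_apply, ofReal_zero] at h1
      exact h1.mono_left nhdsWithin_le_nhds
    have hL' : Tendsto (fun t : ℝ => ∫ x : Fin n → SpaceTime d, 𝔚 (fun j => complexifyPoint (x j) +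
        ((t : ℂ) * I) • complexifyPoint ((timeLift η' : Fin n → SpaceTime d) j)) * boostGen i G x)
        (𝓝[>] 0) (𝓝 0) := by
      refine hR.congr' ?_
      filter_upwards [self_mem_nhdsWithin] with t ht
      exact (hKI t ht).symm
    exact tendsto_nhds_unique hlimL hL'
  -- density of compactly supported test functions
  obtain ⟨u, hu, hlim⟩ := exists_hasCompactSupport_tendsto G
  have hcont : Continuous fun F : 𝓢((Fin n → SpaceTime d), ℂ) => T (boostGen i F) :=
    T.continuous.comp (boostGen i).continuous
  have h1 : Tendsto (fun m => T (boostGen i (u m))) atTop (𝓝 (T (boostGen i G))) :=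
    (hcont.tendsto G).comp hlim
  have h2 : (fun m => T (boostGen i (u m))) = fun _ => (0 : ℂ) := funext fun m => hcs (u m) (hu m)
  rw [h2] at h1
  exact (tendsto_nhds_unique h1 tendsto_const_nhds)

end BoundaryValue

end Literature.MathematicalPhysics.QuantumFieldTheory
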